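import Summits.CriticalPhenomena.PercolationContinuityZ3.Theorems.Transplant.SkelFrmFrom1ReachRowsQUV
import Summits.CriticalPhenomena.PercolationContinuityZ3.Theorems.Transplant.SkelFrmQuasiBChoiceDefsVPx
import Summits.CriticalPhenomena.PercolationContinuityZ3.Theorems.Transplant.SkelFrmQuasiBChoiceAtQVPx
import Summits.CriticalPhenomena.PercolationContinuityZ3.Theorems.Transplant.SkelFrmQuasiBChoiceZonePx
import Summits.CriticalPhenomena.PercolationContinuityZ3.Theorems.Transplant.SkelFrmQuasiBChoiceZoneKPx
import Summits.CriticalPhenomena.PercolationContinuityZ3.Theorems.Transplant.PlanarSkeletonFrmQuasiDefs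
import Summits.CriticalPhenomena.PercolationContinuityZ3.Theorems.Transplant.SkelFrmQuasi1SlotTypes
import Summits.CriticalPhenomena.PercolationContinuityZ3.Theorems.Transplant.SkelFrmQuasiBChoiceRoomsT
import Summits.CriticalPhenomena.PercolationContinuityZ3.Theorems.Transplant.SkelFrmQuasiBChoiceGeomV
import Summits.CriticalPhenomena.PercolationContinuityZ3.Theorems.Transplant.SkelFrmQuasi1ReachRowsQD
import Summits.CriticalPhenomena.PercolationContinuityZ3.Theorems.Transplant.SkelFrmQuasiBParamsSchedA
import Summits.CriticalPhenomena.PercolationContinuityZ3.Theorems.Transplant.SkelFrmQuasiBParamsCorrKG0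
import Summits.CriticalPhenomena.PercolationContinuityZ3.Theorems.Transplant.SkelPhiCorridorKGRoomsQYUVQ
import Summits.CriticalPhenomena.PercolationContinuityZ3.Theorems.Transplant.SkelPhiCorridorKGYRegions
import Summits.CriticalPhenomena.PercolationContinuityZ3.Theorems.Transplant.SkelPhiNegReachDeepOV
import HarnessLib

/-!
# GEN-Q PORT (WAVE-Q table v0.8 section 2, row G251, U-level L?; captain R-6/R-7 2026-08-27: carrier token swap `PlanarSkeletonFrmFrom ↦ PlanarSkeletonFrmQuasi`)
# of the tree module «Transplant/SkelFrmFrom1ReachRowsQUVPxK» (sha256 6f7445c7f62c0d94…) onto the quasi-step carrier `PlanarSkeletonFrmQuasi` (p507026): «SkelFrmQuasi1ReachRowsQUVPxK»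

HAND HUNK (L-FLOORMAP-1 ①⑥ / L-KitS-1 reader side; G017 «SkelFrmQuasiBChoiceNums», hp-8's KitSN): R'0×10, R'0_eq×3, j₁0×1, kk0×1, counts_atq_root×1, hNk0_at×1, kit0_sizes×1, r₀0_ge×3, r₀0×10, hreach_kit0×1, hr₀_kit0×1, tanOff_kit0×1, kit0×6 — the (S0) kit of record at window cost `KS.NQ Φ`.

HAND HUNKS (K-2 reader; UNCHECKED until gen-1's «…BChoiceRoomsT»/«…GeomV»/«…ZonePx/ZoneKPx» and p3's «…DefsVPx/AtQVPx» Q-rows are staged — their `colVT*/geom_fineA_at_bV` must take `hq : QStepsN …` and `colVT_mem_graphBall_lin` must read `Φ.M·cOffS·‖y‖₁ + 1`): (ii) `steps_φL ↦ qStepsN_φL` (5+1 `hstep ↦ hq` sites incl. `weakSteps_fineA_at/colVT/colVT_eq/colVT_mem_graphBall_lin/geom_fineA_at_bV`), callee `Skelφ.reachOblAtHNF_of_kgCorrYVU ↦ …Q` with `(hstep := …) ↦ (hqφ := hq)`; (iv)/① `KS0.kit0/kit0_ok/kit0_sizes/hr₀_kit0/hreach_kit0/tanOff_kit0/r₀0/r₀0_ge/R'0/R'0_eq/j₁0/kk0/hNk0_at/counts_atq_root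 ↦ …N (KS.NQ Φ)` (bin/ks_hunks.py), `hPN ↦ (kit0N_costs …).1`, `hE`'s last summand `KCmax ↦ kit0N.N·KCmax`; ⑤ `hRD : (cOffS·‖tgt e‖₁ + 1) + (10+3)·(…) ≤ R ↦ (Φ.M·cOffS·‖tgt e‖₁ + 1) + Φ.M·(10+3)·(…) ≤ R` (discharged upstream by gen-1's «…BChoiceDepth» `hRD_Q` ×Φ.M, L-FLOORMAP-1 ⑤). Theorem RENAMED `…Q`.

IMPORT FIX (stmt-g34, L-stmt34-1): the K-1 FrmFrom sibling import gives no Quasi names — added the Quasi/φ-level providers SkelFrmQuasiBChoiceRoomsT, SkelFrmQuasiBChoiceGeomV, SkelFrmQuasi1ReachRowsQD, SkelFrmQuasiBParamsSchedA, SkelFrmQuasiBParamsCorrKG0, SkelPhiCorridorKGRoomsQYUVQ, SkelPhiCorridorKGYRegions, SkelPhiNegReachDeepOV.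

ORIGINAL TITLE: 

builds on p205010 (kernel theorem, internal audit signed; external expert review pending) — nothing in this file uses p205010; NOTHING is claimed about any open node
((N3-b), the end state).  Lane `prim-bschramm`, seat `prim-bschramm-stmt` (gen 33; GEN-Q column pen; tool = captain gen-1 g4's port_genq.py R-14 --cone + p3-g30's T1 patch).  Helper file (`--supports stmt-CriticalPhenomena-4575 --as helper`).
PORT RULES (U-wave r1–r4 re-used, GEN-Q hunk classes of p3-g29 #6136): declaration order, names and proof texts are those of «SkelFrmFrom1ReachRowsQUVPxK», byte-identical except
(i) the carrier token `PlanarSkeletonFrmFrom ↦ PlanarSkeletonFrmQuasi` in binders, `namespace`/`end` lines and qualified names (module names `SkelFrmFrom… ↦ SkelFrmQuasi…`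
in imports of already-ported rows); (ii) `Φ.step ↦ Φ.qstep` with the called Steps lemma replaced by its `…Q`/`_q` twin and the cost `Φ.M` threaded (none in this file unless
listed below); (iii) `Φ.cyl_connected ↦ Φ.cyl_reach` readers (none unless listed); (iv) graph-ball radii / window floors ×`Φ.M` (none unless listed).  Carrier-free
residents stay imported/exported from the original «SkelFrm1ReachRowsQUVPxK» exactly as in the FrmFrom port.  Docstrings and citations are the original's.

-/

noncomputable section

open MeasureTheory ProbabilityTheory
open scoped ENNReal Classical

namespace Summit.CriticalPhenomena.PercolationContinuityZ3.Theorems.Transplant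

namespace PlanarSkeletonFrmQuasi

open Literature.Probability.Percolation Literature.Probability.LatticeModels SimpleGraph GadgetSystem ProbeHistory HSiteScheme Contour KNCells
open Literature.Probability.Percolation.KozmaNitzan.Cells (oth sgOf)
open KNCells.KSchA KNLevels ChainPlanar ChainPara
open Literature.Barriers.CriticalPhenomena (HasExponentialGrowth graphBall graphBall_mono mem_graphBall_self)
open Skel (ReachOblAtHNF excess)
open SkelI (tanOff)
open SkelConc (Consts)
open BoxProdZ2 (ConcRadiiG)
open TwoAxis.Para (modulus)
open Skelφ (oriφ trφ)
open Skelφ.StepI (DataN DataNS OutNS)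

namespace NegB

open Neg

section Fst

variable {κ : Consts} {V : Type} [DecidableEq V] [Countable V] {G : SimpleGraph V} [G.LocallyFinite] {Φ : PlanarSkeletonFrmQuasi G} {t : V} {p : unitInterval}
  {hC : Φ.CylSubcritical p} {gv fv : Neg.FSlot} {Pv : PSlot} {Sv : SSlot} {cv hv : CSlot} {bv : BSlot} {O : OutNS V} {q : unitInterval}

/-- (GEN-Q K-2 reader of stmt-g33's binder row «SkelPhiCorridorKGRoomsQYUVQ» `Skelφ.reachOblAtHNF_of_kgCorrYVUQ`: quasi-step producer `qStepsN_φL` (cost `Φ.M`), the cost-`KS.NQ Φ` kit `KS0.kit0N` with `hPN := (kit0N_costs …).1 : Φ.M·13 ≤ N`, `hE` with the quasi-column `N·KCmax`, the depth row `hRD` with `D₀ := Φ.M·cOffS·‖tgt e‖₁ + 1` and slope `Φ.M·(10+3)`; renamed `…Q` — the statement changed.) [UNDER PROXIES, K-2 SHAPE: kit at `(Dk, mkP)` with `hRK`; junction = the explicit radius-`(RK mk + D)` prism at `(O, mk)`; long radius `RL + D`; `hAt` of the Px data]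
**THE (C) RESIDUE OF THE CHOICE FUNCTION OF RECORD AT ONE PROBE, SECOND AXIS** (over `reachOblAtHNF_of_kgCorrYV`; the schedule's frame rows are the
`KGYRows` fields `hn/hv/hlay`). [cite: KozmaNitzan2024, §4 Lemma 12 (pp. 23–25), p. 30 (Step IV)] -/
theorem reachOblAtHNF_frmQ3VD_sndUPxKQ {κ : Consts} {V : Type} [DecidableEq V] [Countable V] {G : SimpleGraph V} [G.LocallyFinite] {Φ : PlanarSkeletonFrmQuasi G} {t : V} {p : unitInterval} {hC : Φ.CylSubcritical p} {gv : Neg.FSlot} {fv : Neg.FSlot} {Pv : PSlot} {Sv : SSlot} {cv : CSlot} {hv : CSlot} {bv : BSlot} {O : OutNS V} {q : unitInterval} {D : ℕ} (hAt : (choiceAtQ3VPx κ Φ t p D Pv gv fv Sv cv hv bv hC).AtQNQ O q) (hP : Φ.HasProxies t D)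
    (hp0 : 0 < (p : ℝ)) (hp1 : (p : ℝ) < 1) (mk : ℕ)
    -- UNDER PROXIES (K-2 shape): the KIT RECORD / INDEX `(Dk, mkP)` for every `KS./KS0.` apron head, tied to the served region at `(O, mk)` by `hRK`
    (Dk : DataNS V) (mkP : ℕ) (hRK : KS.RK t O.merged mk + D ≤ KS.RK t Dk mkP)
    -- the probe
    {h : ProbeHistory V} {e : Site 2 × MDir} (hV : (((KSchA.mk (ΓQV κ Φ t p O gv fv Sv cv hv bv q) q κ.δ : KSchA V ℕ))).Valid₂O G h e) (hdu : ((((1 : Fin 2), true) : MDir)) ∈ (((KSchA.mk (ΓQV κ Φ t p O gv fv Sv cv hv bv q) q κ.δ : KSchA V ℕ))).onwardO G h (tgt e)) (hne : ((((1 : Fin 2), true) : MDir)) ≠ rev e.2)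
    -- the corridor of record, second axis: the K-G row set at `R′ := KS0.R'0` and a run length `N` (stmt-g20: `kgYRows0_of …`, `N := kgNYv0 …`)
    {ρ qq W : ℕ} (HK : Skelφ.KGYRows (nL κ Φ t p O.merged (gOf κ Φ t p O gv) (fOf κ Φ t p O fv)) (ℓL κ Φ t p O.merged (gOf κ Φ t p O gv) (fOf κ Φ t p O fv)) (hL κ Φ t p O.merged (gOf κ Φ t p O gv) (fOf κ Φ t p O fv)) (vL κ Φ t p O.merged (gOf κ Φ t p O gv) (fOf κ Φ t p O fv)) (KS0.R'0N κ Φ (KS.NQ Φ) t p Dk mkP) ρ qq W) (N : ℕ)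
    -- the window radius
    {R : ℕ} (hr₀R : KS0.r₀0N (KS.NQ Φ) t Dk mkP (RL κ Φ t p O gv fv + D) ≤ R)
    -- RADIUS ROWS of the schedule of record
    (hDQ : R + 1 ≤ ((schedOfT κ Φ t p O.merged (gOf κ Φ t p O gv) (fOf κ Φ t p O fv) (cOf κ Φ t p O gv fv cv) (Sv κ Φ t p O.merged (gOf κ Φ t p O gv) (fOf κ Φ t p O fv) q))).rQ ((((KSchA.mk (ΓQV κ Φ t p O gv fv Sv cv hv bv q) q κ.δ : KSchA V ℕ))).aOf₁O G h e) (tgt e))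
    (hDρ' : ∀ l, R + 1 ≤ ((schedOfT κ Φ t p O.merged (gOf κ Φ t p O gv) (fOf κ Φ t p O fv) (cOf κ Φ t p O gv fv cv) (Sv κ Φ t p O.merged (gOf κ Φ t p O gv) (fOf κ Φ t p O fv) q))).ρ ((((KSchA.mk (ΓQV κ Φ t p O gv fv Sv cv hv bv q) q κ.δ : KSchA V ℕ))).aOf₂O G h e) (tgt e) ((((1 : Fin 2), true) : MDir)) l)
    (hρM : ∀ l, ((schedOfT κ Φ t p O.merged (gOf κ Φ t p O gv) (fOf κ Φ t p O fv) (cOf κ Φ t p O gv fv cv) (Sv κ Φ t p O.merged (gOf κ Φ t p O gv) (fOf κ Φ t p O fv) q))).ρ ((((KSchA.mk (ΓQV κ Φ t p O gv fv Sv cv hv bv q) q κ.δ : KSchA V ℕ))).aOf₂O G h e) (tgt e) ((((1 : Fin 2), true) : MDir)) l + 1 ≤ ((schedOfT κ Φ t p O.merged (gOf κ Φ t p O gv) (fOf κ Φ t p O fv) (cOf κ Φ t p O gv fv cv) (Sv κ Φ t p O.merged (gOf κ Φ t p O gv) (fOf κ Φ t p O fv) q))).rM ((((KSchA.mk (ΓQV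 κ Φ t p O gv fv Sv cv hv bv q) q κ.δ : KSchA V ℕ))).aOf₂O G h e) (tgt e + stepVec ((((1 : Fin 2), true) : MDir))))
    -- THE ENTRANCE DEPTH (J15; the wrapper: `deep_of_run₂bOV`, `R₀ := E(nS α v)`)
    {R₀ : ℕ} (hdeep : ∀ a ∈ (((KSchA.mk (ΓQV κ Φ t p O gv fv Sv cv hv bv q) q κ.δ : KSchA V ℕ))).Vx G h, ∀ b ∈ (((KSchA.mk (ΓQV κ Φ t p O gv fv Sv cv hv bv q) q κ.δ : KSchA V ℕ))).Γ.Ewv ((((KSchA.mk (ΓQV κ Φ t p O gv fv Sv cv hv bv q) q κ.δ : KSchA V ℕ))).aOf₁O G h e) e.1 e.2 ∪ ((FDQV κ Φ t p O gv fv Sv cv hv q)).Hfull ((((KSchA.mk (ΓQV κ Φ t p O gv fv Sv cv hv bv q) q κ.δ : KSchA V ℕ))).aOf₂O G h e) (tgt e) ((((1 : Fin 2), true) : MDir)),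
      b ∉ (((KSchA.mk (ΓQV κ Φ t p O gv fv Sv cv hv bv q) q κ.δ : KSchA V ℕ))).Vx G h → G.Adj a b → a ∈ graphBall G t R₀)
    -- PER-REGION READING ROWS of the second-axis corridor (J17; boxes e.g. `kgCorrSchedY_region_run_box/_park₁_box/_park₂_box`)
    (hPR : ∀ k ≤ (Skelφ.kgCorrSchedY HK.hn HK.hv HK.hlay (HK.kgYVals_ok₁ N) (HK.kgYVals_ok₂ N) (HK.kgYVals_split N)).N, ∃ lo hi : Site 2,
      (Skelφ.kgCorrSchedY HK.hn HK.hv HK.hlay (HK.kgYVals_ok₁ N) (HK.kgYVals_ok₂ N) (HK.kgYVals_split N)).region k ⊆ Finset.Icc lo hi ∧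
      (-(5 * (((fcellsV κ Φ t p O.merged (gOf κ Φ t p O gv) (fOf κ Φ t p O fv) (cOf κ Φ t p O gv fv cv) (hOf κ Φ t p O gv fv hv))).r 1 : ℤ)) + 1 ≤ Skelφ.rdLo ((prFA κ Φ t p O.merged (gOf κ Φ t p O gv) (fOf κ Φ t p O fv))).A (nL κ Φ t p O.merged (gOf κ Φ t p O gv) (fOf κ Φ t p O fv)) (hL κ Φ t p O.merged (gOf κ Φ t p O gv) (fOf κ Φ t p O fv)) (vL κ Φ t p O.merged (gOf κ Φ t p O gv) (fOf κ Φ t p O fv)) (vβL κ Φ t p O.merged (gOf κ Φ t p O gv) (fOf κ Φ t p O fv)) ((prFA κ Φ t p O.merged (gOf κ Φ t p O gv) (fOf κ Φ t p O fv))).c₀ ((prFA κ Φ t p O.merged (gOf κ Φ t p O gv) (fOf κ Φ t p O fv))).c₁ ((prFA κ Φ t p O.merged (gOf κ Φ t p O gv) (fOf κ Φ t p O fv))).D lo hi 1 ∧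
        Skelφ.rdHi ((prFA κ Φ t p O.merged (gOf κ Φ t p O gv) (fOf κ Φ t p O fv))).A (nL κ Φ t p O.merged (gOf κ Φ t p O gv) (fOf κ Φ t p O fv)) (hL κ Φ t p O.merged (gOf κ Φ t p O gv) (fOf κ Φ t p O fv)) (vL κ Φ t p O.merged (gOf κ Φ t p O gv) (fOf κ Φ t p O fv)) (vβL κ Φ t p O.merged (gOf κ Φ t p O gv) (fOf κ Φ t p O fv)) ((prFA κ Φ t p O.merged (gOf κ Φ t p O gv) (fOf κ Φ t p O fv))).c₀ ((prFA κ Φ t p O.merged (gOf κ Φ t p O gv) (fOf κ Φ t p O fv))).c₁ ((prFA κ Φ t p O.merged (gOf κ Φ t p O gv) (fOf κ Φ t p O fv))).D lo hi 1 ≤ 22 * (((fcellsV κ Φ t p O.merged (gOf κ Φ t p O gv) (fOf κ Φ t p O fv) (cOf κ Φ t p O gv fv cv) (hOf κ Φ t p O gv fv hv))).r 1 : ℤ) - 1) ∧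
      (-(((fcellsV κ Φ t p O.merged (gOf κ Φ t p O gv) (fOf κ Φ t p O fv) (cOf κ Φ t p O gv fv cv) (hOf κ Φ t p O gv fv hv))).hB 1 : ℤ) + 1 ≤ Skelφ.rdLo ((prFA κ Φ t p O.merged (gOf κ Φ t p O gv) (fOf κ Φ t p O fv))).A (nL κ Φ t p O.merged (gOf κ Φ t p O gv) (fOf κ Φ t p O fv)) (hL κ Φ t p O.merged (gOf κ Φ t p O gv) (fOf κ Φ t p O fv)) (vL κ Φ t p O.merged (gOf κ Φ t p O gv) (fOf κ Φ t p O fv)) (vβL κ Φ t p O.merged (gOf κ Φ t p O gv) (fOf κ Φ t p O fv)) ((prFA κ Φ t p O.merged (gOf κ Φ t p O gv) (fOf κ Φ t p O fv))).c₀ ((prFA κ Φ t p O.merged (gOf κ Φ t p O gv) (fOf κ Φ t p O fv))).c₁ ((prFA κ Φ t p O.merged (gOf κ Φ t p O gv) (fOf κ Φ t p O fv))).D lo hi 0 ∧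
        Skelφ.rdHi ((prFA κ Φ t p O.merged (gOf κ Φ t p O gv) (fOf κ Φ t p O fv))).A (nL κ Φ t p O.merged (gOf κ Φ t p O gv) (fOf κ Φ t p O fv)) (hL κ Φ t p O.merged (gOf κ Φ t p O gv) (fOf κ Φ t p O fv)) (vL κ Φ t p O.merged (gOf κ Φ t p O gv) (fOf κ Φ t p O fv)) (vβL κ Φ t p O.merged (gOf κ Φ t p O gv) (fOf κ Φ t p O fv)) ((prFA κ Φ t p O.merged (gOf κ Φ t p O gv) (fOf κ Φ t p O fv))).c₀ ((prFA κ Φ t p O.merged (gOf κ Φ t p O gv) (fOf κ Φ t p O fv))).c₁ ((prFA κ Φ t p O.merged (gOf κ Φ t p O gv) (fOf κ Φ t p O fv))).D lo hi 0 ≤ (((fcellsV κ Φ t p O.merged (gOf κ Φ t p O gv) (fOf κ Φ t p O fv) (cOf κ Φ t p O gv fv cv) (hOf κ Φ t p O gv fv hv))).hF 1 : ℤ) - 1))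
    -- READING ROWS of the arrival box `[kgLastLoY, kgLastHiY]` (SkelPhiCorridorKGBoxes)
    (hLl : 20 * (((fcellsV κ Φ t p O.merged (gOf κ Φ t p O gv) (fOf κ Φ t p O fv) (cOf κ Φ t p O gv fv cv) (hOf κ Φ t p O gv fv hv))).r 1 : ℤ) - (bOf κ Φ t p O gv fv bv) 1 + 1 ≤ Skelφ.rdLo ((prFA κ Φ t p O.merged (gOf κ Φ t p O gv) (fOf κ Φ t p O fv))).A (nL κ Φ t p O.merged (gOf κ Φ t p O gv) (fOf κ Φ t p O fv)) (hL κ Φ t p O.merged (gOf κ Φ t p O gv) (fOf κ Φ t p O fv)) (vL κ Φ t p O.merged (gOf κ Φ t p O gv) (fOf κ Φ t p O fv)) (vβL κ Φ t p O.merged (gOf κ Φ t p O gv) (fOf κ Φ t p O fv)) ((prFA κ Φ t p O.merged (gOf κ Φ t p O gv) (fOf κ Φ t p O fv))).c₀ ((prFA κ Φ t p O.merged (gOf κ Φ t p O gv) (fOf κ Φ t p O fv))).c₁ ((prFA κ Φ t p O.merged (gOf κ Φ t p O gv) (fOf κ Φ t p O fv))).D (HK.kgLastLoY N) (HK.kgLastHiY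 N) 1 ∧
      5 * (((fcellsV κ Φ t p O.merged (gOf κ Φ t p O gv) (fOf κ Φ t p O fv) (cOf κ Φ t p O gv fv cv) (hOf κ Φ t p O gv fv hv))).r 1 : ℤ) ≤ Skelφ.rdLo ((prFA κ Φ t p O.merged (gOf κ Φ t p O gv) (fOf κ Φ t p O fv))).A (nL κ Φ t p O.merged (gOf κ Φ t p O gv) (fOf κ Φ t p O fv)) (hL κ Φ t p O.merged (gOf κ Φ t p O gv) (fOf κ Φ t p O fv)) (vL κ Φ t p O.merged (gOf κ Φ t p O gv) (fOf κ Φ t p O fv)) (vβL κ Φ t p O.merged (gOf κ Φ t p O gv) (fOf κ Φ t p O fv)) ((prFA κ Φ t p O.merged (gOf κ Φ t p O gv) (fOf κ Φ t p O fv))).c₀ ((prFA κ Φ t p O.merged (gOf κ Φ t p O gv) (fOf κ Φ t p O fv))).c₁ ((prFA κ Φ t p O.merged (gOf κ Φ t p O gv) (fOf κ Φ t p O fv))).D (HK.kgLastLoY N) (HK.kgLastHiY N) 1 ∧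
      Skelφ.rdHi ((prFA κ Φ t p O.merged (gOf κ Φ t p O gv) (fOf κ Φ t p O fv))).A (nL κ Φ t p O.merged (gOf κ Φ t p O gv) (fOf κ Φ t p O fv)) (hL κ Φ t p O.merged (gOf κ Φ t p O gv) (fOf κ Φ t p O fv)) (vL κ Φ t p O.merged (gOf κ Φ t p O gv) (fOf κ Φ t p O fv)) (vβL κ Φ t p O.merged (gOf κ Φ t p O gv) (fOf κ Φ t p O fv)) ((prFA κ Φ t p O.merged (gOf κ Φ t p O gv) (fOf κ Φ t p O fv))).c₀ ((prFA κ Φ t p O.merged (gOf κ Φ t p O gv) (fOf κ Φ t p O fv))).c₁ ((prFA κ Φ t p O.merged (gOf κ Φ t p O gv) (fOf κ Φ t p O fv))).D (HK.kgLastLoY N) (HK.kgLastHiY N) 1 ≤ 20 * (((fcellsV κ Φ t p O.merged (gOf κ Φ t p O gv) (fOf κ Φ t p O fv) (cOf κ Φ t p O gv fv cv) (hOf κ Φ t p O gv fv hv))).r 1 : ℤ) + (bOf κ Φ t p O gv fv bv) 1 - 1 ∧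
      Skelφ.rdHi ((prFA κ Φ t p O.merged (gOf κ Φ t p O gv) (fOf κ Φ t p O fv))).A (nL κ Φ t p O.merged (gOf κ Φ t p O gv) (fOf κ Φ t p O fv)) (hL κ Φ t p O.merged (gOf κ Φ t p O gv) (fOf κ Φ t p O fv)) (vL κ Φ t p O.merged (gOf κ Φ t p O gv) (fOf κ Φ t p O fv)) (vβL κ Φ t p O.merged (gOf κ Φ t p O gv) (fOf κ Φ t p O fv)) ((prFA κ Φ t p O.merged (gOf κ Φ t p O gv) (fOf κ Φ t p O fv))).c₀ ((prFA κ Φ t p O.merged (gOf κ Φ t p O gv) (fOf κ Φ t p O fv))).c₁ ((prFA κ Φ t p O.merged (gOf κ Φ t p O gv) (fOf κ Φ t p O fv))).D (HK.kgLastLoY N) (HK.kgLastHiY N) 1 ≤ 22 * (((fcellsV κ Φ t p O.merged (gOf κ Φ t p O gv) (fOf κ Φ t p O fv) (cOf κ Φ t p O gv fv cv) (hOf κ Φ t p O gv fv hv))).r 1 : ℤ))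
    (hLt : ((fcellsV κ Φ t p O.merged (gOf κ Φ t p O gv) (fOf κ Φ t p O fv) (cOf κ Φ t p O gv fv cv) (hOf κ Φ t p O gv fv hv))).cenS (tgt e + stepVec ((((1 : Fin 2), true) : MDir))) 0 - ((fcellsV κ Φ t p O.merged (gOf κ Φ t p O gv) (fOf κ Φ t p O fv) (cOf κ Φ t p O gv fv cv) (hOf κ Φ t p O gv fv hv))).cenS (tgt e) 0 - (bOf κ Φ t p O gv fv bv) 0 + 1 ≤ Skelφ.rdLo ((prFA κ Φ t p O.merged (gOf κ Φ t p O gv) (fOf κ Φ t p O fv))).A (nL κ Φ t p O.merged (gOf κ Φ t p O gv) (fOf κ Φ t p O fv)) (hL κ Φ t p O.merged (gOf κ Φ t p O gv) (fOf κ Φ t p O fv)) (vL κ Φ t p O.merged (gOf κ Φ t p O gv) (fOf κ Φ t p O fv)) (vβL κ Φ t p O.merged (gOf κ Φ t p O gv) (fOf κ Φ t p O fv)) ((prFA κ Φ t p O.merged (gOf κ Φ t p O gv) (fOf κ Φ t p O fv))).c₀ ((prFA κ Φ t p O.merged (gOf κ Φ t p O gv) (fOf κ Φ t p O fv))).c₁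 ((prFA κ Φ t p O.merged (gOf κ Φ t p O gv) (fOf κ Φ t p O fv))).D (HK.kgLastLoY N) (HK.kgLastHiY N) 0 ∧
      Skelφ.rdHi ((prFA κ Φ t p O.merged (gOf κ Φ t p O gv) (fOf κ Φ t p O fv))).A (nL κ Φ t p O.merged (gOf κ Φ t p O gv) (fOf κ Φ t p O fv)) (hL κ Φ t p O.merged (gOf κ Φ t p O gv) (fOf κ Φ t p O fv)) (vL κ Φ t p O.merged (gOf κ Φ t p O gv) (fOf κ Φ t p O fv)) (vβL κ Φ t p O.merged (gOf κ Φ t p O gv) (fOf κ Φ t p O fv)) ((prFA κ Φ t p O.merged (gOf κ Φ t p O gv) (fOf κ Φ t p O fv))).c₀ ((prFA κ Φ t p O.merged (gOf κ Φ t p O gv) (fOf κ Φ t p O fv))).c₁ ((prFA κ Φ t p O.merged (gOf κ Φ t p O gv) (fOf κ Φ t p O fv))).D (HK.kgLastLoY N) (HK.kgLastHiY N) 0 ≤ ((fcellsV κ Φ t p O.merged (gOf κ Φ t p O gv) (fOf κ Φ t p O fv) (cOf κ Φ t p O gv fv cv) (hOf κ Φ t p O gv fv hv))).cenS (tgt e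 + stepVec ((((1 : Fin 2), true) : MDir))) 0 - ((fcellsV κ Φ t p O.merged (gOf κ Φ t p O gv) (fOf κ Φ t p O fv) (cOf κ Φ t p O gv fv cv) (hOf κ Φ t p O gv fv hv))).cenS (tgt e) 0 + (bOf κ Φ t p O gv fv bv) 0 - 1 ∧
      -(((fcellsV κ Φ t p O.merged (gOf κ Φ t p O gv) (fOf κ Φ t p O fv) (cOf κ Φ t p O gv fv cv) (hOf κ Φ t p O gv fv hv))).hB 1 : ℤ) ≤ Skelφ.rdLo ((prFA κ Φ t p O.merged (gOf κ Φ t p O gv) (fOf κ Φ t p O fv))).A (nL κ Φ t p O.merged (gOf κ Φ t p O gv) (fOf κ Φ t p O fv)) (hL κ Φ t p O.merged (gOf κ Φ t p O gv) (fOf κ Φ t p O fv)) (vL κ Φ t p O.merged (gOf κ Φ t p O gv) (fOf κ Φ t p O fv)) (vβL κ Φ t p O.merged (gOf κ Φ t p O gv) (fOf κ Φ t p O fv)) ((prFA κ Φ t p O.merged (gOf κ Φ t p O gv) (fOf κ Φ t p O fv))).c₀ ((prFA κ Φ t p O.merged (gOf κ Φ t p O gv) (fOf κ Φ t p O fv))).c₁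 ((prFA κ Φ t p O.merged (gOf κ Φ t p O gv) (fOf κ Φ t p O fv))).D (HK.kgLastLoY N) (HK.kgLastHiY N) 0 ∧
      Skelφ.rdHi ((prFA κ Φ t p O.merged (gOf κ Φ t p O gv) (fOf κ Φ t p O fv))).A (nL κ Φ t p O.merged (gOf κ Φ t p O gv) (fOf κ Φ t p O fv)) (hL κ Φ t p O.merged (gOf κ Φ t p O gv) (fOf κ Φ t p O fv)) (vL κ Φ t p O.merged (gOf κ Φ t p O gv) (fOf κ Φ t p O fv)) (vβL κ Φ t p O.merged (gOf κ Φ t p O gv) (fOf κ Φ t p O fv)) ((prFA κ Φ t p O.merged (gOf κ Φ t p O gv) (fOf κ Φ t p O fv))).c₀ ((prFA κ Φ t p O.merged (gOf κ Φ t p O gv) (fOf κ Φ t p O fv))).c₁ ((prFA κ Φ t p O.merged (gOf κ Φ t p O gv) (fOf κ Φ t p O fv))).D (HK.kgLastLoY N) (HK.kgLastHiY N) 0 ≤ (((fcellsV κ Φ t p O.merged (gOf κ Φ t p O gv) (fOf κ Φ t p O fv) (cOf κ Φ t p O gv fv cv) (hOf κ Φ t p O gv fv hv))).hF 1 : ℤ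))
    -- START-BOX ROWS (`aW ≤ (n ± v) + W`, `bL ≤ qq`)
    {aW Bx bL : ℤ} (ha : ((prFA κ Φ t p O.merged (gOf κ Φ t p O gv) (fOf κ Φ t p O fv))).D * (((prFA κ Φ t p O.merged (gOf κ Φ t p O gv) (fOf κ Φ t p O fv))).c₁ * ((nL κ Φ t p O.merged (gOf κ Φ t p O gv) (fOf κ Φ t p O fv)) : ℤ) * ((bOf κ Φ t p O gv fv bv) 0 + 1) + ((prFA κ Φ t p O.merged (gOf κ Φ t p O gv) (fOf κ Φ t p O fv))).c₀ * |(vL κ Φ t p O.merged (gOf κ Φ t p O gv) (fOf κ Φ t p O fv))| * ((bOf κ Φ t p O gv fv bv) 1 + 1)) ≤ ((prFA κ Φ t p O.merged (gOf κ Φ t p O gv) (fOf κ Φ t p O fv))).c₀ * ((prFA κ Φ t p O.merged (gOf κ Φ t p O gv) (fOf κ Φ t p O fv))).c₁ * ((prFA κ Φ t p O.merged (gOf κ Φ t p O gv) (fOf κ Φ t p O fv))).A * modulus (nL κ Φ t p O.merged (gOf κ Φ t p O gv) (fOf κ Φ t p O fv)) (hL κ Φ t p O.merged (gOf κ Φ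 t p O gv) (fOf κ Φ t p O fv)) (vL κ Φ t p O.merged (gOf κ Φ t p O gv) (fOf κ Φ t p O fv)) (vβL κ Φ t p O.merged (gOf κ Φ t p O gv) (fOf κ Φ t p O fv)) * aW)
    (hBx : ((prFA κ Φ t p O.merged (gOf κ Φ t p O gv) (fOf κ Φ t p O fv))).D * (((bOf κ Φ t p O gv fv bv) 1 : ℤ) + 1) ≤ ((prFA κ Φ t p O.merged (gOf κ Φ t p O gv) (fOf κ Φ t p O fv))).c₁ * ((prFA κ Φ t p O.merged (gOf κ Φ t p O gv) (fOf κ Φ t p O fv))).A * Bx) (hbL : Bx / (Skelφ.shearUnit (nL κ Φ t p O.merged (gOf κ Φ t p O gv) (fOf κ Φ t p O fv)) (hL κ Φ t p O.merged (gOf κ Φ t p O gv) (fOf κ Φ t p O fv)) : ℤ) + 1 ≤ bL)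
    (haW : aW ≤ (((((nL κ Φ t p O.merged (gOf κ Φ t p O gv) (fOf κ Φ t p O fv)) : ℤ) + (vL κ Φ t p O.merged (gOf κ Φ t p O gv) (fOf κ Φ t p O fv))).toNat + W : ℕ) : ℤ)) (haW' : aW ≤ (((((nL κ Φ t p O.merged (gOf κ Φ t p O gv) (fOf κ Φ t p O fv)) : ℤ) - (vL κ Φ t p O.merged (gOf κ Φ t p O gv) (fOf κ Φ t p O fv))).toNat + W : ℕ) : ℤ)) (hbq : bL ≤ qq)
    -- DEPTH ROW
    (hRD : ((Φ.M * cOffS κ Φ t p O.merged (gOf κ Φ t p O gv) (fOf κ Φ t p O fv) * (((tgt e) 0).natAbs + ((tgt e) 1).natAbs) + 1 : ℕ) : ℤ) +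
      Φ.M * (10 + 3) * (((N : ℤ) + 1) * (((nL κ Φ t p O.merged (gOf κ Φ t p O gv) (fOf κ Φ t p O fv)) * (ℓL κ Φ t p O.merged (gOf κ Φ t p O gv) (fOf κ Φ t p O fv)) / Skelφ.shearUnit (nL κ Φ t p O.merged (gOf κ Φ t p O gv) (fOf κ Φ t p O fv)) (hL κ Φ t p O.merged (gOf κ Φ t p O gv) (fOf κ Φ t p O fv)) + 1 : ℕ) : ℤ) +
        Skelφ.kgZY₀ (nL κ Φ t p O.merged (gOf κ Φ t p O gv) (fOf κ Φ t p O fv)) (vL κ Φ t p O.merged (gOf κ Φ t p O gv) (fOf κ Φ t p O fv)) (KS0.R'0N κ Φ (KS.NQ Φ) t p Dk mkP) ρ W N (Skelφ.kgM₁Y (nL κ Φ t p O.merged (gOf κ Φ t p O gv) (fOf κ Φ t p O fv)) (vL κ Φ t p O.merged (gOf κ Φ t p O gv) (fOf κ Φ t p O fv)) (KS0.R'0N κ Φ (KS.NQ Φ) t p Dk mkP) ρ W N) (Skelφ.kgWm₂Y (nL κ Φ t p O.merged (gOf κ Φ t p O gv) (fOf κ Φ t p O fv)) (vL κ Φ t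 p O.merged (gOf κ Φ t p O gv) (fOf κ Φ t p O fv)) (KS0.R'0N κ Φ (KS.NQ Φ) t p Dk mkP) ρ W N) (Skelφ.kgWp₂Y (nL κ Φ t p O.merged (gOf κ Φ t p O gv) (fOf κ Φ t p O fv)) (vL κ Φ t p O.merged (gOf κ Φ t p O gv) (fOf κ Φ t p O fv)) (KS0.R'0N κ Φ (KS.NQ Φ) t p Dk mkP) ρ W N) (Skelφ.kgM₂Y (nL κ Φ t p O.merged (gOf κ Φ t p O gv) (fOf κ Φ t p O fv)) (ℓL κ Φ t p O.merged (gOf κ Φ t p O gv) (fOf κ Φ t p O fv)) (hL κ Φ t p O.merged (gOf κ Φ t p O gv) (fOf κ Φ t p O fv)) (vL κ Φ t p O.merged (gOf κ Φ t p O gv) (fOf κ Φ t p O fv)) (KS0.R'0N κ Φ (KS.NQ Φ) t p Dk mkP) ρ qq W N) + Skelφ.kgZY₁ (nL κ Φ t p O.merged (gOf κ Φ t p O gv) (fOf κ Φ t p O fv)) (ℓL κ Φ t p O.merged (gOf κ Φ t p O gv) (fOf κ Φ t p O fv)) (hL κ Φ t p O.merged (gOf κ Φ t p O gv) (fOf κ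 Φ t p O fv)) (KS0.R'0N κ Φ (KS.NQ Φ) t p Dk mkP) ρ qq N (Skelφ.kgM₁Y (nL κ Φ t p O.merged (gOf κ Φ t p O gv) (fOf κ Φ t p O fv)) (vL κ Φ t p O.merged (gOf κ Φ t p O gv) (fOf κ Φ t p O fv)) (KS0.R'0N κ Φ (KS.NQ Φ) t p Dk mkP) ρ W N) (Skelφ.kgM₂Y (nL κ Φ t p O.merged (gOf κ Φ t p O gv) (fOf κ Φ t p O fv)) (ℓL κ Φ t p O.merged (gOf κ Φ t p O gv) (fOf κ Φ t p O fv)) (hL κ Φ t p O.merged (gOf κ Φ t p O gv) (fOf κ Φ t p O fv)) (vL κ Φ t p O.merged (gOf κ Φ t p O gv) (fOf κ Φ t p O fv)) (KS0.R'0N κ Φ (KS.NQ Φ) t p Dk mkP) ρ qq W N)) ≤ R)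
    -- THE RIM EXCESS DEVICE: world rows, excess radius
    {φe : V → Site 2} {Rw m' m R₁ : ℕ} {ctr : Site 2}
    (hWπ : ∀ b ∈ (((KSchA.mk (ΓQV κ Φ t p O gv fv Sv cv hv bv q) q κ.δ : KSchA V ℕ))).Γ.Ewv ((((KSchA.mk (ΓQV κ Φ t p O gv fv Sv cv hv bv q) q κ.δ : KSchA V ℕ))).aOf₁O G h e) e.1 e.2 ∪ ((FDQV κ Φ t p O gv fv Sv cv hv q)).Hfull ((((KSchA.mk (ΓQV κ Φ t p O gv fv Sv cv hv bv q) q κ.δ : KSchA V ℕ))).aOf₂O G h e) (tgt e) ((((1 : Fin 2), true) : MDir)), b ∈ graphBall G t Rw)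
    (hWpl : ∀ b ∈ (((KSchA.mk (ΓQV κ Φ t p O gv fv Sv cv hv bv q) q κ.δ : KSchA V ℕ))).Γ.Ewv ((((KSchA.mk (ΓQV κ Φ t p O gv fv Sv cv hv bv q) q κ.δ : KSchA V ℕ))).aOf₁O G h e) e.1 e.2 ∪ ((FDQV κ Φ t p O gv fv Sv cv hv q)).Hfull ((((KSchA.mk (ΓQV κ Φ t p O gv fv Sv cv hv bv q) q κ.δ : KSchA V ℕ))).aOf₂O G h e) (tgt e) ((((1 : Fin 2), true) : MDir)), φe b ∈ (box 2 m').image (fun s => s + ctr))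
    (hm : 2 * m' ≤ m)
    (hR₁ : ∀ R'', R₁ ≤ R'' → ∀ (Rw' : ℕ) (D' A' : Finset V), (∀ d ∈ D', d ∈ graphBall G t Rw') →
      (∀ d ∈ D', ∀ d' ∈ D', φe d - φe d' ∈ box 2 m) → A' ⊆ D' → (∀ a ∈ A', a ∈ graphBall G t (R₀ + 1)) →
        (bondPercolation G q).real (excess G t R'' D' A') ≤ κ.δr 0 / 2)
    (hR₁R : R₁ ≤ R - KS0.r₀0N (KS.NQ Φ) t Dk mkP (RL κ Φ t p O gv fv + D))
    -- the budget
    {nmax : ℕ} (hnmax : (Skelφ.kgCorrSchedYU HK.hn HK.hv HK.hlay (HK.kgYVals_ok₁ N) (HK.kgYVals_ok₂ N) (HK.kgYVals_split N)).N ≤ nmax) :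
    ReachOblAtHNF G nmax ((KSchA.mk (ΓQV κ Φ t p O gv fv Sv cv hv bv q) q κ.δ : KSchA V ℕ)) (FDQV κ Φ t p O gv fv Sv cv hv q) Φ.Δ (κ.δr 0) h e ((((KSchA.mk (ΓQV κ Φ t p O gv fv Sv cv hv bv q) q κ.δ : KSchA V ℕ))).aOf₂O G h e) ((((1 : Fin 2), true) : MDir)) := by
  -- the long clause and its numerics
  have hN := eqNumL_of_atQV (atQ3V_of_atQ3VPx hAt)
  obtain ⟨hn1, hℓ1⟩ := one_le_of_eqNumL κ Φ t p O.merged (gOf κ Φ t p O gv) (fOf κ Φ t p O fv) hN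
  have hκL := (clauseL_of_atQV (atQ3V_of_atQ3VPx hAt)).2
  obtain ⟨-, hq1, hq2, -⟩ := factsNS_of_atQV (atQ3V_of_atQ3VPx hAt)
  -- the short region UNDER PROXIES (K-2 shape, as «SkelFrmFrom1RootHoldsQCKVPx» :146–:163): the kit parallelogram about `c` at radius `RK mk + D`
  -- («SkelFrmFromBChoiceZoneKPx» prism form) — inside `B(c, Rs(Dk, mkP))` by `hRK`, of cardinality `≤ cUA(Dk, mkP)`, containing the zone `Λ (prox c) M_u`
  have hRg : ∀ c, ∀ u ∈ Skelφ.pgramPrismFin G (KS.φK Φ t O.D O.DT.toDataN O.ori mk) c (KS.nKit O.merged mk) (KS.hKit t O.merged mk) (3 * KS.ℓKit t O.merged mk) (KS.RK t O.merged mk + D),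
      u ∈ graphBall G c (KS.Rs t Dk mkP) := fun c u hu =>
    graphBall_mono G c (hRK.trans (KS.RK_le_Rs t Dk mkP).1)
      (Skelφ.cylBall_subset_prism G (KS.φK Φ t O.D O.DT.toDataN O.ori mk) c _ _ ((Skelφ.mem_pgramPrismFin G (KS.φK Φ t O.D O.DT.toDataN O.ori mk)).1 hu).1).1
  have hRgcard : ∀ c, (Skelφ.pgramPrismFin G (KS.φK Φ t O.D O.DT.toDataN O.ori mk) c (KS.nKit O.merged mk) (KS.hKit t O.merged mk) (3 * KS.ℓKit t O.merged mk) (KS.RK t O.merged mk + D)).card ≤ KS.cUA Φ t Dk mkP := fun c => by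
    classical
    refine le_trans (Finset.card_le_card fun v hv => ?_) ((Skelφ.card_cylBallFin_le (φ := KS.φK Φ t O.D O.DT.toDataN O.ori mk) Φ.degree_le c
      (Skelφ.pgScale (KS.nKit O.merged mk) (KS.hKit t O.merged mk) (3 * KS.ℓKit t O.merged mk)) (KS.RK t O.merged mk + D)).trans
      (Nat.pow_le_pow_right (Nat.succ_pos _) hRK))
    rw [Skelφ.mem_cylBallFin]
    exact ((Skelφ.mem_pgramPrismFin G (KS.φK Φ t O.D O.DT.toDataN O.ori mk)).1 hv).1
  have hΛRgK : ∀ c, O.merged.Λ (hP.prox c) (Mu O.merged) ⊆ Skelφ.pgramPrismFin G (KS.φK Φ t O.D O.DT.toDataN O.ori mk) c (KS.nKit O.merged mk) (KS.hKit t O.merged mk) (3 * KS.ℓKit t O.merged mk) (KS.RK t O.merged mk + D) := fun c a ha =>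
    (Skelφ.mem_pgramPrismFin G (KS.φK Φ t O.D O.DT.toDataN O.ori mk)).2 (hΛRg_of_atQPx mk (atQ3_of_atQ3VPx hAt) hP (D_le_nKit_of_atQ3VPx hAt mk) c (Finset.mem_coe.2 ha))
  -- the frame
  have hlipφ := lip_φL κ Φ t p O.D O.DT.toDataN O.ori (gOf κ Φ t p O gv) (fOf κ Φ t p O fv)
  -- GEN-Q hand hunk (ii): the exact-footprint quasi-step producer of record (p3-g30's G026 «SkelFrmQuasiBParamsLO»)
  have hq := qStepsN_φL κ Φ t p O.D O.DT.toDataN O.ori (gOf κ Φ t p O gv) (fOf κ Φ t p O fv)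
  -- the Γ package at the staggered cells
  obtain ⟨-, -, -, -, -, -, hEx, hSt, hLG⟩ := geom_fineA_at_bV κ Φ t p O.merged (gOf κ Φ t p O gv) (fOf κ Φ t p O fv) (cOf κ Φ t p O gv fv cv) (hOf κ Φ t p O gv fv hv) hlipφ hq hN
    (schedOfT_WFS2 κ Φ t p O.merged (gOf κ Φ t p O gv) (fOf κ Φ t p O fv) (cOf κ Φ t p O gv fv cv) (Sv κ Φ t p O.merged (gOf κ Φ t p O gv) (fOf κ Φ t p O fv) q)) (colQ_schedOfT κ Φ t p O.merged (gOf κ Φ t p O gv) (fOf κ Φ t p O fv) (cOf κ Φ t p O gv fv cv) (Sv κ Φ t p O.merged (gOf κ Φ t p O gv) (fOf κ Φ t p O fv) q))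
    (b₀ := (bOf κ Φ t p O gv fv bv)) (bOf_leV κ Φ t p O gv fv cv hv bv)
  -- the kit block
  -- GEN-Q hand hunk (L-FLOORMAP-1 ① reader): the cost-`NQ` kit of record; `hPN : Φ.M·(10+3) ≤ kit0N.N` from `kit0N_costs`, the N-free rows from `kit0N_ok`
  obtain ⟨-, hdD, hDρ, hKCmax, hT⟩ := KS0.kit0N_ok (KS.NQ Φ) t Dk mkP ((Mu Dk + 1 : ℕ) * (Skelφ.shearUnit (nL κ Φ t p O.merged (gOf κ Φ t p O gv) (fOf κ Φ t p O fv)) (hL κ Φ t p O.merged (gOf κ Φ t p O gv) (fOf κ Φ t p O fv)) : ℤ) + 1)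
    (KS0.r₀0N (KS.NQ Φ) t Dk mkP (RL κ Φ t p O gv fv + D)) (kq := 10) le_rfl
  have hPN := (KS0.kit0N_costs Φ t Dk mkP ((Mu Dk + 1 : ℕ) * (Skelφ.shearUnit (nL κ Φ t p O.merged (gOf κ Φ t p O gv) (fOf κ Φ t p O fv)) (hL κ Φ t p O.merged (gOf κ Φ t p O gv) (fOf κ Φ t p O fv)) : ℤ) + 1)
    (KS0.r₀0N (KS.NQ Φ) t Dk mkP (RL κ Φ t p O gv fv + D)) (kq := 10) le_rfl).1
  obtain ⟨hrs, hcS⟩ := KS0.kit0N_sizes Φ (KS.NQ Φ) t Dk mkP ((Mu Dk + 1 : ℕ) * (Skelφ.shearUnit (nL κ Φ t p O.merged (gOf κ Φ t p O gv) (fOf κ Φ t p O fv)) (hL κ Φ t p O.merged (gOf κ Φ t p O gv) (fOf κ Φ t p O fv)) : ℤ) + 1) (KS0.r₀0N (KS.NQ Φ) t Dk mkP (RL κ Φ t p O gv fv + D))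
  obtain ⟨hr₀, hr₀1⟩ := KS0.hr₀_kit0N (KS.one_le_NQ Φ) t Dk mkP ((Mu Dk + 1 : ℕ) * (Skelφ.shearUnit (nL κ Φ t p O.merged (gOf κ Φ t p O gv) (fOf κ Φ t p O fv)) (hL κ Φ t p O.merged (gOf κ Φ t p O gv) (fOf κ Φ t p O fv)) : ℤ) + 1) (KS0.r₀0N_ge (KS.NQ Φ) t Dk mkP (RL κ Φ t p O gv fv + D)).1
  have hreach := KS0.hreach_kit0N (KS.NQ Φ) t Dk mkP ((Mu Dk + 1 : ℕ) * (Skelφ.shearUnit (nL κ Φ t p O.merged (gOf κ Φ t p O gv) (fOf κ Φ t p O fv)) (hL κ Φ t p O.merged (gOf κ Φ t p O gv) (fOf κ Φ t p O fv)) : ℤ) + 1) (KS0.r₀0N_ge (KS.NQ Φ) t Dk mkP (RL κ Φ t p O gv fv + D)).2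
  -- the counts at the flat root accuracy
  obtain ⟨hk, hcount⟩ := KS0.counts_atqN_root κ Φ (KS.NQ Φ) t p Dk mkP hp0 hp1 hq1 hq2
  -- levels
  have hE : KS0.j₁0N κ Φ (KS.NQ Φ) t p Dk mkP +
      ((KS0.kit0N (KS.NQ Φ) t Dk mkP ((Mu Dk + 1 : ℕ) * (Skelφ.shearUnit (nL κ Φ t p O.merged (gOf κ Φ t p O gv) (fOf κ Φ t p O fv)) (hL κ Φ t p O.merged (gOf κ Φ t p O gv) (fOf κ Φ t p O fv)) : ℤ) + 1) (KS0.r₀0N (KS.NQ Φ) t Dk mkP (RL κ Φ t p O gv fv + D))).N *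
          (tanOff (KS0.kit0N (KS.NQ Φ) t Dk mkP ((Mu Dk + 1 : ℕ) * (Skelφ.shearUnit (nL κ Φ t p O.merged (gOf κ Φ t p O gv) (fOf κ Φ t p O fv)) (hL κ Φ t p O.merged (gOf κ Φ t p O gv) (fOf κ Φ t p O fv)) : ℤ) + 1) (KS0.r₀0N (KS.NQ Φ) t Dk mkP (RL κ Φ t p O gv fv + D))).ℓs
            (KS0.kit0N (KS.NQ Φ) t Dk mkP ((Mu Dk + 1 : ℕ) * (Skelφ.shearUnit (nL κ Φ t p O.merged (gOf κ Φ t p O gv) (fOf κ Φ t p O fv)) (hL κ Φ t p O.merged (gOf κ Φ t p O gv) (fOf κ Φ t p O fv)) : ℤ) + 1) (KS0.r₀0N (KS.NQ Φ) t Dk mkP (RL κ Φ t p O gv fv + D))).M + 1) +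
        (KS0.kit0N (KS.NQ Φ) t Dk mkP ((Mu Dk + 1 : ℕ) * (Skelφ.shearUnit (nL κ Φ t p O.merged (gOf κ Φ t p O gv) (fOf κ Φ t p O fv)) (hL κ Φ t p O.merged (gOf κ Φ t p O gv) (fOf κ Φ t p O fv)) : ℤ) + 1) (KS0.r₀0N (KS.NQ Φ) t Dk mkP (RL κ Φ t p O gv fv + D))).N *
          (KS0.kit0N (KS.NQ Φ) t Dk mkP ((Mu Dk + 1 : ℕ) * (Skelφ.shearUnit (nL κ Φ t p O.merged (gOf κ Φ t p O gv) (fOf κ Φ t p O fv)) (hL κ Φ t p O.merged (gOf κ Φ t p O gv) (fOf κ Φ t p O fv)) : ℤ) + 1) (KS0.r₀0N (KS.NQ Φ) t Dk mkP (RL κ Φ t p O gv fv + D))).d +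
        (KS0.kit0N (KS.NQ Φ) t Dk mkP ((Mu Dk + 1 : ℕ) * (Skelφ.shearUnit (nL κ Φ t p O.merged (gOf κ Φ t p O gv) (fOf κ Φ t p O fv)) (hL κ Φ t p O.merged (gOf κ Φ t p O gv) (fOf κ Φ t p O fv)) : ℤ) + 1) (KS0.r₀0N (KS.NQ Φ) t Dk mkP (RL κ Φ t p O gv fv + D))).N *
          KS.KCmax t Dk mkP) ≤ KS0.R'0N κ Φ (KS.NQ Φ) t p Dk mkP := by
    rw [KS0.tanOff_kit0N]
    simp only [KS0.kit0N]
    have h := (KS0.R'0N_eq κ Φ (KS.NQ Φ) t p Dk mkP).1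
    unfold KS0.reach0N at h
    omega
  exact Skelφ.reachOblAtHNF_of_kgCorrYVUQ (φ := (φL κ Φ t p O.D O.DT.toDataN O.ori (gOf κ Φ t p O gv) (fOf κ Φ t p O fv))) (ψ := (fineOA κ Φ t p O.D O.DT.toDataN O.ori (gOf κ Φ t p O gv) (fOf κ Φ t p O fv))) (P := (fcellsV κ Φ t p O.merged (gOf κ Φ t p O gv) (fOf κ Φ t p O fv) (cOf κ Φ t p O gv fv cv) (hOf κ Φ t p O gv fv hv))) (w₀ := t) (Λ := (schedOfT κ Φ t p O.merged (gOf κ Φ t p O gv) (fOf κ Φ t p O fv) (cOf κ Φ t p O gv fv cv) (Sv κ Φ t p O.merged (gOf κ Φ t p O gv) (fOf κ Φ t p O fv) q))) (b₀ := (bOf κ Φ t p O gv fv bv)) (q := q) (δc := κ.δ)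
    (hψ := fineOA_eq_fineSkel) (hAp := (Aof_pos κ).1) (hmp := Skelφ.NegPrm.modulus_vβOf_pos hn1 hℓ1 _ _)
    (hc₀p := (prFA_c_pos κ Φ t p O.merged (gOf κ Φ t p O gv) (fOf κ Φ t p O fv)).1) (hc₁p := (prFA_c_pos κ Φ t p O.merged (gOf κ Φ t p O gv) (fOf κ Φ t p O fv)).2)
    (hDp := Skelφ.NegPrm.DofA_pos (Aof_pos κ).2 hn1 hℓ1 _ _)
    (hlip := lip_fineA_at κ Φ t p O.merged (gOf κ Φ t p O gv) (fOf κ Φ t p O fv) hlipφ hN) (hws := weakSteps_fineA_at κ Φ t p O.merged (gOf κ Φ t p O gv) (fOf κ Φ t p O fv) hq hN)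
    (hb := bOf_leV κ Φ t p O gv fv cv hv bv) (hL := hLG) (hSt := hSt) (hEx := hEx) (hV := hV) (hdu := hdu) (hdu' := hne)
    (hlipφ := hlipφ) (hqφ := hq) (hΔ := Φ.degree_le) (hn := HK.hn) (hvn := HK.hv) (hlay := HK.hlay)
    (c₀ := colVT κ Φ t p O.merged (gOf κ Φ t p O gv) (fOf κ Φ t p O fv) (cOf κ Φ t p O gv fv cv) hlipφ hq hN (tgt e)) (kq := 10) (hκL := hκL)
    (hctr := colVT_eq κ Φ t p O.merged (gOf κ Φ t p O gv) (fOf κ Φ t p O fv) (cOf κ Φ t p O gv fv cv) hlipφ hq hN (tgt e))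
    (hP₁ := HK.kgYVals_ok₁ N) (hP₂ := HK.kgYVals_ok₂ N) (hsplit := HK.kgYVals_split N) (r := RL κ Φ t p O gv fv + D) (hr := le_rfl)
    (hrR := le_trans (Nat.le_add_right _ _) ((KS0.r₀0N_ge (KS.NQ Φ) t Dk mkP (RL κ Φ t p O gv fv + D)).2.trans hr₀R))
    (Pk := KS0.kit0N (KS.NQ Φ) t Dk mkP ((Mu Dk + 1 : ℕ) * (Skelφ.shearUnit (nL κ Φ t p O.merged (gOf κ Φ t p O gv) (fOf κ Φ t p O fv)) (hL κ Φ t p O.merged (gOf κ Φ t p O gv) (fOf κ Φ t p O fv)) : ℤ) + 1) (KS0.r₀0N (KS.NQ Φ) t Dk mkP (RL κ Φ t p O gv fv + D)))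
    (hPN := hPN) (hA := rfl) (hdD := hdD) (hDρ := hDρ) (hKCmax := hKCmax) (hT := hT) (hr₀ := hr₀) (hR := hr₀R) (hr₀1 := hr₀1)
    (hrs := hrs) (hcS := hcS) (hreach := hreach)
    (Rg := fun c => Skelφ.pgramPrismFin G (KS.φK Φ t O.D O.DT.toDataN O.ori mk) c (KS.nKit O.merged mk) (KS.hKit t O.merged mk) (3 * KS.ℓKit t O.merged mk) (KS.RK t O.merged mk + D))
    (hRg := hRg) (hRgcard := hRgcard)
    (hcU1 := Nat.one_le_pow _ _ (Nat.succ_pos _))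
    (Λc := fun c => O.merged.Λ (hP.prox c)) (kz := Mu O.merged) (hΛRg := hΛRgK)
    (hzconn := hzconn_of_atQPx (atQ3_of_atQ3VPx hAt) hP (D_le_Mu_of_atQ3VPx hAt)) (hcz := hcz_of_atQPx (atQ3_of_atQ3VPx hAt) hP (D_le_Mu_of_atQ3VPx hAt))
    (hj0 := (KS0.tanOff_kit0N (KS.NQ Φ) t Dk mkP _ _).le) (hj := (KS0.R'0N_eq κ Φ (KS.NQ Φ) t p Dk mkP).2.2) (hRl := (KS0.R'0N_eq κ Φ (KS.NQ Φ) t p Dk mkP).2.1.le)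
    (hE := hE) (hδ := (κ.hδr 0).1) (hη := le_rfl) (kk := KS0.kk0N κ Φ (KS.NQ Φ) t p Dk mkP) (hN := KS0.hNk0N_at κ Φ (KS.NQ Φ) t p Dk mkP hp0 hp1)
    (hk := hk) (hcount := hcount)
    (hDQ := hDQ) (hDρ' := hDρ') (hρM := hρM) (hdeep := hdeep) (hPR := hPR) (hlast := fun y hy => HK.mem_Icc_of_mem_lastY N hy) (hLl := hLl) (hLt := hLt)
    (ha := ha) (hBx := hBx) (hbL := hbL) (haW := haW) (haW' := haW') (hbq := hbq)
    (hc₀ := colVT_mem_graphBall_lin κ Φ t p O.merged (gOf κ Φ t p O gv) (fOf κ Φ t p O fv) (cOf κ Φ t p O gv fv cv) hlipφ hq hN hκL (tgt e)) (hRD := hRD)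
    (hWπ := hWπ) (hWpl := hWpl) (hm := hm) (hR₁ := hR₁) (hR₁R := hR₁R)
    (hlong := hlong_of_atQ3VPx (atQ3V_of_atQ3VPx hAt) hP (D_le_nL_of_atQ3VPx hAt _ _) (Neg.δkit_le_δr κ Φ (by norm_num)))
    (hlongY := hlongY_of_atQ3VPx (atQ3V_of_atQ3VPx hAt) hP (D_le_nL_of_atQ3VPx hAt _ _) (Neg.δkit_le_δr κ Φ (by norm_num)))
    (hnmax := hnmax)

end Fst

end NegB

end PlanarSkeletonFrmQuasi

end Summit.CriticalPhenomena.PercolationContinuityZ3.Theorems.Transplant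

end
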